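import Summits.CriticalPhenomena.PercolationContinuityZ3.Theorems.PercNearOneGluingNoHeavyLowerTailIncStarApexForestConcave
import HarnessLib

/-!
# (D′) ON APEX-FORESTS: revealing non-root pairs never raises Sahi's cubic on average

Support file for the Sahi programme (`--supports stmt-CriticalPhenomena-4575`, prover prim-sahi-p2 gen 20).  No definitions, no named
facts, no sorries; standard axioms.  Memo `run/shared/lean/prim/prim-sahi/prim-sahi-p2/PROOF-E3.md` §27h–§28 ((D′), the dual revelation of
gen 17), §30 (FC); lead g120 §8 (j).

`(D′)` (`…IncStarDualRevelation`, hypothesis there, never asserted): with `F` a set of non-root pairs and `w^O` (`O ⊆ F`) the weight pinning `O`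
open and `F ∖ O` closed, `Σ_{O ⊆ F} π(O)·E₃(w^O) ≤ E₃(w)`, `π(O) = Π_{f∈O} w f · Π_{f∈F∖O} (1 − w f)`, `E₃ = E₃({s↔a},{s↔b},{s↔c})`.  It is an
AVERAGED chord statement; on general graphs it is open (no known failure).  THIS FILE proves it on apex-forests:

**Theorem `dualRevelation_of_apexForest`.**  If the environment with all pairs of `F` switched on, `fromEdgeSet {z | s ∉ z ∧ (w z ≠ 0 ∨ z ∈ F)}`,
is acyclic (and the pairs of `F` are non-diagonal and avoid `s`), then `Σ_{O ⊆ F} π(O)·E₃(w^O) ≤ E₃(w)` for all targets.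
Proof: induction on `F`; the step is THEOREM FC's chord inequality along the inserted pair (`IncStar.incStar_pair_chord_of_apexForest`) and the
splitting `Σ_{O ⊆ insert e F′} = (1 − w e)·Σ^{w[e↦0]}_{O ⊆ F′} + (w e)·Σ^{w[e↦1]}_{O ⊆ F′}` (`Finset.sum_powerset_insert`).
In particular (`F` = the fractional non-loop pairs avoiding `s`) the hypothesis `(D′)` of `IncStar.incStar_nonneg_of_dualRevelation_at` holds on
every apex-forest.
-/

noncomputable section

namespace Summit.CriticalPhenomena.PercolationContinuityZ3.Theorems

namespace IncStar

open MeasureTheory Set Literature.Probability.Percolation Literature.Probability.LatticeModels EdgeInduction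
open scoped Classical

variable {n : ℕ}

/-- **(D′) on apex-forests.**  For a finite set `F` of non-diagonal pairs avoiding `s` such that the environment with `F` switched on is
acyclic, the `π`-average of Sahi's cubic over the pinnings of `F` is at most Sahi's cubic. [this work] -/
theorem dualRevelation_of_apexForest (w : Sym2 (Fin n) → unitInterval) (s a b c : Fin n) (F : Finset (Sym2 (Fin n)))
    (hF : ∀ z ∈ F, ¬ z.IsDiag ∧ s ∉ z)
    (hforest : (SimpleGraph.fromEdgeSet {z : Sym2 (Fin n) | s ∉ z ∧ (w z ≠ 0 ∨ z ∈ F)}).IsAcyclic) :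
    ∑ O ∈ F.powerset, (∏ f ∈ O, (w f : ℝ)) * (∏ f ∈ F \ O, (1 - (w f : ℝ))) *
        sahiE3 (prodBernoulli (fun f => if f ∈ O then (1 : unitInterval) else if f ∈ F then 0 else w f))
          (openConn s a) (openConn s b) (openConn s c)
      ≤ sahiE3 (prodBernoulli w) (openConn s a) (openConn s b) (openConn s c) := by
  induction F using Finset.induction_on generalizing w with
  | empty =>
    rw [Finset.powerset_empty, Finset.sum_singleton, Finset.prod_empty, Finset.empty_sdiff, Finset.prod_empty]
    have hw : (fun f => if f ∈ (∅ : Finset (Sym2 (Fin n))) then (1 : unitInterval)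
        else if f ∈ (∅ : Finset (Sym2 (Fin n))) then 0 else w f) = w := by
      funext f
      rw [if_neg (Finset.notMem_empty f), if_neg (Finset.notMem_empty f)]
    rw [hw, one_mul, one_mul]
  | insert e F' heF ih =>
    -- bookkeeping for the inserted pair
    have he : ¬ e.IsDiag ∧ s ∉ e := hF e (Finset.mem_insert_self e F')
    have hF' : ∀ z ∈ F', ¬ z.IsDiag ∧ s ∉ z := fun z hz => hF z (Finset.mem_insert_of_mem hz)
    have hmono : ∀ (val : unitInterval),
        SimpleGraph.fromEdgeSet {z : Sym2 (Fin n) | s ∉ z ∧ (Function.update w e val z ≠ 0 ∨ z ∈ F')}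
          ≤ SimpleGraph.fromEdgeSet {z : Sym2 (Fin n) | s ∉ z ∧ (w z ≠ 0 ∨ z ∈ insert e F')} := by
      intro val x y hxy
      rw [SimpleGraph.fromEdgeSet_adj] at hxy ⊢
      obtain ⟨⟨hs, hw⟩, hne⟩ := hxy
      refine ⟨⟨hs, ?_⟩, hne⟩
      by_cases h : s(x, y) = e
      · exact Or.inr (h ▸ Finset.mem_insert_self e F')
      · rw [Function.update_of_ne h] at hw
        exact hw.imp id Finset.mem_insert_of_mem
    have hf0 := hforest.anti (hmono 0)
    have hf1 := hforest.anti (hmono 1)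
    have hfe : (SimpleGraph.fromEdgeSet {z : Sym2 (Fin n) | s ∉ z ∧ Function.update w e 1 z ≠ 0}).IsAcyclic := by
      refine hforest.anti fun x y hxy => ?_
      rw [SimpleGraph.fromEdgeSet_adj] at hxy ⊢
      obtain ⟨⟨hs, hw⟩, hne⟩ := hxy
      refine ⟨⟨hs, ?_⟩, hne⟩
      by_cases h : s(x, y) = e
      · exact Or.inr (h ▸ Finset.mem_insert_self e F')
      · rw [Function.update_of_ne h] at hw
        exact Or.inl hw
    -- the two halves of the sum are the sums for `w[e↦0]` and `w[e↦1]` over the subsets of `F'`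
    have ih0 := ih (Function.update w e 0) hF' hf0
    have ih1 := ih (Function.update w e 1) hF' hf1
    have hne_of_mem : ∀ {f : Sym2 (Fin n)}, f ∈ F' → f ≠ e := fun hf h => heF (h ▸ hf)
    have hprodO : ∀ (val : unitInterval), ∀ O ∈ F'.powerset,
        ∏ f ∈ O, ((Function.update w e val f : unitInterval) : ℝ) = ∏ f ∈ O, (w f : ℝ) := by
      intro val O hO
      refine Finset.prod_congr rfl fun f hf => ?_
      rw [Function.update_of_ne (hne_of_mem (Finset.mem_powerset.1 hO hf))]
    have hprodC : ∀ (val : unitInterval), ∀ O ∈ F'.powerset,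
        ∏ f ∈ F' \ O, (1 - ((Function.update w e val f : unitInterval) : ℝ)) = ∏ f ∈ F' \ O, (1 - (w f : ℝ)) := by
      intro val O _
      refine Finset.prod_congr rfl fun f hf => ?_
      rw [Function.update_of_ne (hne_of_mem (Finset.mem_sdiff.1 hf).1)]
    have hpin0 : ∀ O ∈ F'.powerset,
        (fun f => if f ∈ O then (1 : unitInterval) else if f ∈ insert e F' then 0 else w f)
          = (fun f => if f ∈ O then (1 : unitInterval) else if f ∈ F' then 0 else Function.update w e 0 f) := by
      intro O hO
      have heO : e ∉ O := fun h => heF (Finset.mem_powerset.1 hO h)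
      funext f
      by_cases hfe : f = e
      · rw [hfe, if_neg heO, if_neg heO, if_pos (Finset.mem_insert_self e F'), if_neg heF, Function.update_self]
      · rw [Function.update_of_ne hfe]
        by_cases hfO : f ∈ O
        · rw [if_pos hfO, if_pos hfO]
        · rw [if_neg hfO, if_neg hfO]
          by_cases hfF : f ∈ F'
          · rw [if_pos (Finset.mem_insert_of_mem hfF), if_pos hfF]
          · rw [if_neg (fun h => hfF ((Finset.mem_insert.1 h).resolve_left hfe)), if_neg hfF]
    have hpin1 : ∀ O ∈ F'.powerset,
        (fun f => if f ∈ insert e O then (1 : unitInterval) else if f ∈ insert e F' then 0 else w f)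
          = (fun f => if f ∈ O then (1 : unitInterval) else if f ∈ F' then 0 else Function.update w e 1 f) := by
      intro O hO
      have heO : e ∉ O := fun h => heF (Finset.mem_powerset.1 hO h)
      funext f
      by_cases hfe : f = e
      · rw [hfe, if_pos (Finset.mem_insert_self e O), if_neg heO, if_neg heF, Function.update_self]
      · rw [Function.update_of_ne hfe]
        by_cases hfO : f ∈ O
        · rw [if_pos (Finset.mem_insert_of_mem hfO), if_pos hfO]
        · rw [if_neg (fun h => hfO ((Finset.mem_insert.1 h).resolve_left hfe)), if_neg hfO]
          by_cases hfF : f ∈ F'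
          · rw [if_pos (Finset.mem_insert_of_mem hfF), if_pos hfF]
          · rw [if_neg (fun h => hfF ((Finset.mem_insert.1 h).resolve_left hfe)), if_neg hfF]
    have hS0 : ∑ O ∈ F'.powerset, (∏ f ∈ O, (w f : ℝ)) * (∏ f ∈ insert e F' \ O, (1 - (w f : ℝ))) *
          sahiE3 (prodBernoulli (fun f => if f ∈ O then (1 : unitInterval) else if f ∈ insert e F' then 0 else w f))
            (openConn s a) (openConn s b) (openConn s c)
        = (1 - (w e : ℝ)) * ∑ O ∈ F'.powerset, (∏ f ∈ O, ((Function.update w e 0 f : unitInterval) : ℝ))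
          * (∏ f ∈ F' \ O, (1 - ((Function.update w e 0 f : unitInterval) : ℝ))) *
          sahiE3 (prodBernoulli (fun f => if f ∈ O then (1 : unitInterval) else if f ∈ F' then 0 else Function.update w e 0 f))
            (openConn s a) (openConn s b) (openConn s c) := by
      rw [Finset.mul_sum]
      refine Finset.sum_congr rfl fun O hO => ?_
      have heO : e ∉ O := fun h => heF (Finset.mem_powerset.1 hO h)
      have hsd : insert e F' \ O = insert e (F' \ O) := Finset.insert_sdiff_of_notMem F' heO
      have heFO : e ∉ F' \ O := fun h => heF (Finset.mem_sdiff.1 h).1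
      rw [hsd, Finset.prod_insert heFO, hprodO 0 O hO, hprodC 0 O hO, hpin0 O hO]
      ring
    have hS1 : ∑ O ∈ F'.powerset, (∏ f ∈ insert e O, (w f : ℝ)) * (∏ f ∈ insert e F' \ insert e O, (1 - (w f : ℝ))) *
          sahiE3 (prodBernoulli (fun f => if f ∈ insert e O then (1 : unitInterval) else if f ∈ insert e F' then 0 else w f))
            (openConn s a) (openConn s b) (openConn s c)
        = (w e : ℝ) * ∑ O ∈ F'.powerset, (∏ f ∈ O, ((Function.update w e 1 f : unitInterval) : ℝ))
          * (∏ f ∈ F' \ O, (1 - ((Function.update w e 1 f : unitInterval) : ℝ))) *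
          sahiE3 (prodBernoulli (fun f => if f ∈ O then (1 : unitInterval) else if f ∈ F' then 0 else Function.update w e 1 f))
            (openConn s a) (openConn s b) (openConn s c) := by
      rw [Finset.mul_sum]
      refine Finset.sum_congr rfl fun O hO => ?_
      have heO : e ∉ O := fun h => heF (Finset.mem_powerset.1 hO h)
      have hsd : insert e F' \ insert e O = F' \ O := by
        rw [Finset.insert_sdiff_of_mem F' (Finset.mem_insert_self e O), Finset.sdiff_insert_of_notMem heF]
      rw [hsd, Finset.prod_insert heO, hprodO 1 O hO, hprodC 1 O hO, hpin1 O hO]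
      ring
    -- the chord inequality along `e` (THEOREM FC)
    have hchord := incStar_pair_chord_of_apexForest w s a b c e he.1 hfe
    have hp0 : (0 : ℝ) ≤ w e := (w e).2.1
    have hp1 : (w e : ℝ) ≤ 1 := (w e).2.2
    rw [Finset.sum_powerset_insert heF, hS0, hS1]
    have h0 := mul_le_mul_of_nonneg_left ih0 (sub_nonneg.2 hp1)
    have h1 := mul_le_mul_of_nonneg_left ih1 hp0
    linarith

/-- **(D′) of `…IncStarDualRevelation` holds on every apex-forest** (pinning set = the fractional non-loop pairs avoiding the root). [this work] -/
theorem dualRevelation_frac_of_apexForest (w : Sym2 (Fin n) → unitInterval) (s a b c : Fin n)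
    (hforest : (SimpleGraph.fromEdgeSet {z : Sym2 (Fin n) | s ∉ z ∧ w z ≠ 0}).IsAcyclic) :
    ∑ O ∈ ((fracEdges w).filter fun e => ¬ e.IsDiag ∧ s ∉ e).powerset,
        (∏ f ∈ O, (w f : ℝ)) * (∏ f ∈ ((fracEdges w).filter fun e => ¬ e.IsDiag ∧ s ∉ e) \ O, (1 - (w f : ℝ))) *
          sahiE3 (prodBernoulli (fun f => if f ∈ O then (1 : unitInterval)
            else if f ∈ ((fracEdges w).filter fun e => ¬ e.IsDiag ∧ s ∉ e) then 0 else w f))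
            (openConn s a) (openConn s b) (openConn s c)
      ≤ sahiE3 (prodBernoulli w) (openConn s a) (openConn s b) (openConn s c) := by
  refine dualRevelation_of_apexForest w s a b c _ (fun z hz => (Finset.mem_filter.1 hz).2) (hforest.anti fun x y hxy => ?_)
  rw [SimpleGraph.fromEdgeSet_adj] at hxy ⊢
  obtain ⟨⟨hs, hw⟩, hne⟩ := hxy
  refine ⟨⟨hs, ?_⟩, hne⟩
  rcases hw with hw | hw
  · exact hw
  · intro h0
    have hf := (Finset.mem_filter.1 hw).1
    simp only [fracEdges, Finset.mem_filter, Finset.mem_univ, true_and] at hf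
    rw [h0] at hf
    simp at hf

end IncStar

end Summit.CriticalPhenomena.PercolationContinuityZ3.Theorems
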